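import Mathlib
import HarnessLib
import Literature.MathematicalPhysics.QuantumLattice.GrassmannEffectiveActionCopies

/-!
# Route `KLProgramme` — crux K3, the nested two-volume pass: LINEAR SUBSTITUTIONS versus BLOCK GLUING — the kernels of
# `(map T′)(Glue V) − Glue ((map T) V)` are windings and cross-block terms (cell gate-hubbard-kl, seat hubbard-kl-k3c4-p1 g8; bracket (iv) of
# VL-STUB-ROUTE-A-g8.md §3 / plan (R51); `--supports` stmt-…-20440)

Generic (model-free) companion of `GrassmannEffectiveActionCopies` (block structure `e : Γ′ ≃ ι × Γ`, block embeddings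
`f_β`, glued element `Glue V = Σ_β V ∘ f_β` = `ι` decoupled copies).  In the nested two-volume comparison of fermionic effective actions
(Salmhofer 1999, §2.6/§4.3; the «semigroup defect» bookkeeping) every change of field representation — re-sectorisation between scales, read-out
of the sectorised step (Benfatto–Giuliani–Mastropietro 2006, (2.70)–(2.71): `𝒱 ↦ 𝔉 * 𝒱`) — is a LINEAR SUBSTITUTION of generators `map (toLin' T)`
(Berezin 1966, Ch. I §3), with a fine matrix `T′ : Γ₂′ × Γ₁′` on the big torus and a coarse one `T : Γ₂ × Γ₁` on the small torus related by
PERIODISATION: summed over the fibre of a coarse column label the fine matrix IS the coarse one,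
`(P_T)  Σ_{π₁ Y′ = Y} T′ X′ Y′ = T (π₂ X′) Y`.
Here, for block structures `e₁ : Γ₁′ ≃ ι × Γ₁` (in-labels) and `e₂ : Γ₂′ ≃ ι × Γ₂` (out-labels) with the same blocks:

* §1 `sum_fibre_eq_sum_blocks` (a fibre is indexed by the blocks), **`prod_coarse_eq_sum_prod_lifts`** — under `(P_T)`,
  `∏_i T (π₂ X′_i) (Y_i) = Σ_{βs : Fin m → ι} ∏_i T′ (X′_i) (lift (βs i) (Y_i))` (every leg lifted to an arbitrary block);
* §2 **`kernel_map_glue_eq`** — `kernel (map T′ (Glue V)) m X′ = Σ_β Σ_Y (∏_i T′(X′_i, lift β Y_i)) · kernel V m Y` (all legs lifted to the SAME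
  block), **`kernel_glue_map_eq`** — `kernel (Glue (map T V)) m X′ = [X′ in one block] · Σ_Y (∏_i T(π₂ X′_i, Y_i)) · kernel V m Y`;
* §3 **`norm_kernel_map_glue_sub_glue_map_le`** — hence, at an out-string `X′` whose reference leg `p` lies in block `β₀`, the defect is bounded by
  `Σ_Y ‖kernel V m Y‖ · ( Σ_{β ≠ β₀} ∏_i ‖T′(X′_i, lift β Y_i)‖  +  [X′ not all in β₀] · ∏_i ‖T′(X′_i, lift β₀ Y_i)‖
  +  [X′ all in β₀] · Σ_{βs ≠ const β₀} ∏_i ‖T′(X′_i, lift (βs i) Y_i)‖ )` — OTHER-BLOCK lifts, CROSS-BLOCK out-strings, and WINDING lifts: each term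
  carries a matrix entry between different blocks, so decay of `T′` beyond the depth of a deep pin makes the pinned defect small (the
  substitution bracket of the two-volume step; the summation with tails is done by the consumer);
* §4 `sum_pinned_prod_eq` — the pinned sum of a leg-wise product: `Σ_{X′ : X′_p = w} ∏_i f_i(X′_i) = f_p(w) · ∏_{i ≠ p} Σ_x f_i(x)`.

Everything is proved; no definition; nothing is asserted about the model.  Model inputs `(P_T)` and translation covariance for the sector-multiplier overlap kernels:
`…TwoVolumeSectorOverlapPeriodisation` (p545360); for the sector-field covariances: `…TwoVolumeSectorPeriodisation` (p544212).

## Sources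
M. Salmhofer, *Renormalization: An Introduction* (Springer 1999), §2.6 Def. 2.19 (2.102)–(2.106), App. B.2 (B.23)–(B.25) [`Salmhofer1999`];
F. A. Berezin, *The Method of Second Quantization* (1966), Ch. I §3 [`Berezin1966`]; G. Benfatto, A. Giuliani, V. Mastropietro, Ann. Henri Poincaré 7
(2006) 809–898, §2.7 (2.70)–(2.71a) [`BenfattoGiulianiMastropietro2006`].
-/

noncomputable section

namespace Summit.HubbardSuperconductivity.HubbardSuperconductivity.Theorems.TwoVolumeDefect

set_option linter.dupNamespace false -- summit = problem name (single-conjunct summit), D-0017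

open Finset Literature.MathematicalPhysics.QuantumLattice GrassmannAlgebra

section SubstitutionGluing

variable {𝕜 : Type*} [RCLike 𝕜] {ι Γ₁ Γ₂ Γ₁' Γ₂' : Type*} [Fintype ι] [DecidableEq ι]
  [Fintype Γ₁] [DecidableEq Γ₁] [Fintype Γ₂] [DecidableEq Γ₂] [Fintype Γ₁'] [DecidableEq Γ₁'] [Fintype Γ₂'] [DecidableEq Γ₂']
  (e₁ : Γ₁' ≃ ι × Γ₁) (e₂ : Γ₂' ≃ ι × Γ₂)

/-! ### §1 Fibres are indexed by the blocks; the coarse product under `(P_T)` -/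

omit [DecidableEq ι] [Fintype Γ₁] [DecidableEq Γ₁'] in
/-- **A fibre of the projection is indexed by the blocks**: `Σ_{Y′ : π Y′ = Y} g Y′ = Σ_β g (e⁻¹ (β, Y))`. [folklore] -/
theorem sum_fibre_eq_sum_blocks {A : Type*} [AddCommMonoid A] (g : Γ₁' → A) (Y : Γ₁) :
    ∑ Y' ∈ univ.filter (fun Y' : Γ₁' => (e₁ Y').2 = Y), g Y' = ∑ β : ι, g (e₁.symm (β, Y)) := by
  classical
  refine Finset.sum_nbij' (fun Y' => (e₁ Y').1) (fun β => e₁.symm (β, Y)) ?_ ?_ ?_ ?_ ?_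
  · intro Y' _; exact mem_univ _
  · intro β _
    simp only [mem_filter, mem_univ, true_and, Equiv.apply_symm_apply]
  · intro Y' hY'
    simp only [mem_filter, mem_univ, true_and] at hY'
    rw [← hY', Prod.mk.eta, Equiv.symm_apply_apply]
  · intro β _
    simp only [Equiv.apply_symm_apply]
  · intro Y' hY'
    simp only [mem_filter, mem_univ, true_and] at hY'
    rw [← hY', Prod.mk.eta, Equiv.symm_apply_apply]

omit [DecidableEq ι] [Fintype Γ₁] [DecidableEq Γ₁'] [Fintype Γ₂] [DecidableEq Γ₂] [Fintype Γ₂'] [DecidableEq Γ₂'] in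
/-- **The coarse leg-wise product under the periodisation `(P_T)`**: `∏_i T (π₂ X′_i) (Y_i) = Σ_{βs : Fin m → ι} ∏_i T′ (X′_i) (e₁⁻¹ (βs i, Y_i))` —
every leg lifted to an arbitrary block. [folklore] -/
theorem prod_coarse_eq_sum_prod_lifts (T : Matrix Γ₂ Γ₁ 𝕜) (T' : Matrix Γ₂' Γ₁' 𝕜)
    (hP : ∀ (X' : Γ₂') (Y : Γ₁), ∑ Y' ∈ univ.filter (fun Y' : Γ₁' => (e₁ Y').2 = Y), T' X' Y' = T (e₂ X').2 Y)
    {m : ℕ} (X' : Fin m → Γ₂') (Y : Fin m → Γ₁) :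
    ∏ i, T (e₂ (X' i)).2 (Y i) = ∑ βs : Fin m → ι, ∏ i, T' (X' i) (e₁.symm (βs i, Y i)) := by
  have h : ∀ i, T (e₂ (X' i)).2 (Y i) = ∑ β ∈ (univ : Finset ι), T' (X' i) (e₁.symm (β, Y i)) := fun i => by
    rw [← hP, sum_fibre_eq_sum_blocks e₁]
  simp_rw [h]
  rw [prod_univ_sum, Fintype.piFinset_univ]

/-! ### §2 The kernels of `map T′ (Glue V)` and of `Glue (map T V)` -/

omit [Fintype Γ₂'] [DecidableEq Γ₂'] in
/-- **Kernels of the substituted glued element**: `kernel (map T′ (Σ_β V ∘ f_β)) (n+1) X′ = Σ_β Σ_Y (∏_i T′(X′_i, e₁⁻¹(β, Y_i))) · kernel V (n+1) Y` —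
the in-legs are lifted to ONE common block (the copies do not couple). [cite: Salmhofer1999, Def. 2.19 (2.102)-(2.106)] -/
theorem kernel_map_glue_eq (T' : Matrix Γ₂' Γ₁' 𝕜)
    (Fe₁ : ι → (Γ₁ → 𝕜) →ₗ[𝕜] (Γ₁' → 𝕜)) (hFe₁ : ∀ β v X', Fe₁ β v X' = if (e₁ X').1 = β then v (e₁ X').2 else 0)
    (V : GrassmannAlgebra 𝕜 Γ₁) {n : ℕ} (p : Fin (n + 1)) (X' : Fin (n + 1) → Γ₂') :
    kernel 𝕜 (ExteriorAlgebra.map (Matrix.toLin' T') (∑ β, ExteriorAlgebra.map (Fe₁ β) V)) (n + 1) X' =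
      ∑ β : ι, ∑ Y : Fin (n + 1) → Γ₁, (∏ i, T' (X' i) (e₁.symm (β, Y i))) * kernel 𝕜 V (n + 1) Y := by
  classical
  rw [kernel_map]
  simp only [LinearMap.toMatrix'_toLin', kernel_copies_sum e₁ Fe₁ hFe₁ V p]
  -- drop the in-strings whose legs are not all in one block, then reindex the rest by (block, projected string)
  simp_rw [mul_ite, mul_zero]
  rw [← Finset.sum_filter, ← Fintype.sum_prod_type']
  refine Finset.sum_nbij' (fun Y' => ((e₁ (Y' p)).1, fun i => (e₁ (Y' i)).2)) (fun q => fun i => e₁.symm (q.1, q.2 i)) ?_ ?_ ?_ ?_ ?_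
  · intro Y' _; exact mem_univ _
  · intro q _
    simp only [mem_filter, mem_univ, true_and, Equiv.apply_symm_apply, implies_true]
  · intro Y' hY'
    simp only [mem_filter, mem_univ, true_and] at hY'
    funext i
    dsimp only
    rw [← hY' i, Prod.mk.eta, Equiv.symm_apply_apply]
  · intro q _
    obtain ⟨β, Y⟩ := q
    simp only [Equiv.apply_symm_apply]
  · intro Y' hY'
    simp only [mem_filter, mem_univ, true_and] at hY'
    dsimp only
    congr 1
    refine prod_congr rfl fun i _ => ?_
    rw [← hY' i, Prod.mk.eta, Equiv.symm_apply_apply]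

omit [Fintype Γ₂'] in
/-- **Kernels of the glued substituted element**: `kernel (Σ_β (map T V) ∘ f_β) (n+1) X′ = [all legs of X′ in the block of leg p] · Σ_Y (∏_i T(π₂ X′_i, Y_i)) ·
kernel V (n+1) Y`. [cite: Salmhofer1999, Def. 2.19 (2.102)-(2.106)] -/
theorem kernel_glue_map_eq (T : Matrix Γ₂ Γ₁ 𝕜)
    (Fe₂ : ι → (Γ₂ → 𝕜) →ₗ[𝕜] (Γ₂' → 𝕜)) (hFe₂ : ∀ β v X', Fe₂ β v X' = if (e₂ X').1 = β then v (e₂ X').2 else 0)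
    (V : GrassmannAlgebra 𝕜 Γ₁) {n : ℕ} (p : Fin (n + 1)) (X' : Fin (n + 1) → Γ₂') :
    kernel 𝕜 (∑ β, ExteriorAlgebra.map (Fe₂ β) (ExteriorAlgebra.map (Matrix.toLin' T) V)) (n + 1) X' =
      if ∀ i, (e₂ (X' i)).1 = (e₂ (X' p)).1 then ∑ Y : Fin (n + 1) → Γ₁, (∏ i, T (e₂ (X' i)).2 (Y i)) * kernel 𝕜 V (n + 1) Y else 0 := by
  rw [kernel_copies_sum e₂ Fe₂ hFe₂ _ p, kernel_map]
  simp only [LinearMap.toMatrix'_toLin']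

/-! ### §3 The defect is windings + cross-block terms -/

omit [Fintype Γ₂'] in
/-- **THE SUBSTITUTION–GLUING DEFECT, pointwise.**  Under `(P_T)`, at every out-string `X′` (reference leg `p`, block `β₀` of `X′_p`):
`‖kernel (map T′ (Glue V)) X′ − kernel (Glue (map T V)) X′‖ ≤ Σ_Y ‖kernel V Y‖ · ( Σ_{β ≠ β₀} ∏_i ‖T′(X′_i, e₁⁻¹(β, Y_i))‖ +
[¬ all legs of X′ in β₀] · ∏_i ‖T′(X′_i, e₁⁻¹(β₀, Y_i))‖ + [all legs of X′ in β₀] · Σ_{βs ≠ const β₀} ∏_i ‖T′(X′_i, e₁⁻¹(βs i, Y_i))‖ )` — every term contains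
an entry of `T′` between DIFFERENT blocks or a winding lift. [folklore] -/
theorem norm_kernel_map_glue_sub_glue_map_le (T : Matrix Γ₂ Γ₁ 𝕜) (T' : Matrix Γ₂' Γ₁' 𝕜)
    (hP : ∀ (X' : Γ₂') (Y : Γ₁), ∑ Y' ∈ univ.filter (fun Y' : Γ₁' => (e₁ Y').2 = Y), T' X' Y' = T (e₂ X').2 Y)
    (Fe₁ : ι → (Γ₁ → 𝕜) →ₗ[𝕜] (Γ₁' → 𝕜)) (hFe₁ : ∀ β v X', Fe₁ β v X' = if (e₁ X').1 = β then v (e₁ X').2 else 0)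
    (Fe₂ : ι → (Γ₂ → 𝕜) →ₗ[𝕜] (Γ₂' → 𝕜)) (hFe₂ : ∀ β v X', Fe₂ β v X' = if (e₂ X').1 = β then v (e₂ X').2 else 0)
    (V : GrassmannAlgebra 𝕜 Γ₁) {n : ℕ} (p : Fin (n + 1)) (X' : Fin (n + 1) → Γ₂') :
    ‖kernel 𝕜 (ExteriorAlgebra.map (Matrix.toLin' T') (∑ β, ExteriorAlgebra.map (Fe₁ β) V)) (n + 1) X' -
        kernel 𝕜 (∑ β, ExteriorAlgebra.map (Fe₂ β) (ExteriorAlgebra.map (Matrix.toLin' T) V)) (n + 1) X'‖ ≤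
      ∑ Y : Fin (n + 1) → Γ₁, ‖kernel 𝕜 V (n + 1) Y‖ *
        ((∑ β ∈ univ.erase (e₂ (X' p)).1, ∏ i, ‖T' (X' i) (e₁.symm (β, Y i))‖) +
          (if ∀ i, (e₂ (X' i)).1 = (e₂ (X' p)).1 then 0 else ∏ i, ‖T' (X' i) (e₁.symm ((e₂ (X' p)).1, Y i))‖) +
          (if ∀ i, (e₂ (X' i)).1 = (e₂ (X' p)).1 then
            ∑ βs ∈ univ.erase (fun _ : Fin (n + 1) => (e₂ (X' p)).1), ∏ i, ‖T' (X' i) (e₁.symm (βs i, Y i))‖ else 0)) := by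
  classical
  set β₀ : ι := (e₂ (X' p)).1 with hβ₀
  rw [kernel_map_glue_eq e₁ T' Fe₁ hFe₁ V p, kernel_glue_map_eq e₂ T Fe₂ hFe₂ V p, Finset.sum_comm]
  -- per in-string `Y`
  have hkey : ∀ Y : Fin (n + 1) → Γ₁,
      ‖(∑ β : ι, (∏ i, T' (X' i) (e₁.symm (β, Y i))) * kernel 𝕜 V (n + 1) Y) -
          (if ∀ i, (e₂ (X' i)).1 = β₀ then (∏ i, T (e₂ (X' i)).2 (Y i)) * kernel 𝕜 V (n + 1) Y else 0)‖ ≤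
        ‖kernel 𝕜 V (n + 1) Y‖ *
          ((∑ β ∈ univ.erase β₀, ∏ i, ‖T' (X' i) (e₁.symm (β, Y i))‖) +
            (if ∀ i, (e₂ (X' i)).1 = β₀ then 0 else ∏ i, ‖T' (X' i) (e₁.symm (β₀, Y i))‖) +
            (if ∀ i, (e₂ (X' i)).1 = β₀ then
              ∑ βs ∈ univ.erase (fun _ : Fin (n + 1) => β₀), ∏ i, ‖T' (X' i) (e₁.symm (βs i, Y i))‖ else 0)) := by
    intro Y
    -- split the block sum at `β₀`, and the lift sum at the constant lift
    rw [← Finset.sum_mul, ← Finset.add_sum_erase univ (fun β => ∏ i, T' (X' i) (e₁.symm (β, Y i))) (mem_univ β₀),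
      prod_coarse_eq_sum_prod_lifts e₁ e₂ T T' hP X' Y,
      ← Finset.add_sum_erase univ (fun βs : Fin (n + 1) → ι => ∏ i, T' (X' i) (e₁.symm (βs i, Y i))) (mem_univ (fun _ => β₀))]
    split_ifs with hin
    · -- all legs in `β₀`: the diagonal terms cancel, other blocks + windings remain
      rw [add_zero, show ((∏ i, T' (X' i) (e₁.symm (β₀, Y i))) + ∑ β ∈ univ.erase β₀, ∏ i, T' (X' i) (e₁.symm (β, Y i))) *
              kernel 𝕜 V (n + 1) Y -
            ((∏ i, T' (X' i) (e₁.symm ((fun _ : Fin (n + 1) => β₀) i, Y i))) +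
                ∑ βs ∈ univ.erase (fun _ : Fin (n + 1) => β₀), ∏ i, T' (X' i) (e₁.symm (βs i, Y i))) * kernel 𝕜 V (n + 1) Y =
          kernel 𝕜 V (n + 1) Y * ((∑ β ∈ univ.erase β₀, ∏ i, T' (X' i) (e₁.symm (β, Y i))) -
            ∑ βs ∈ univ.erase (fun _ : Fin (n + 1) => β₀), ∏ i, T' (X' i) (e₁.symm (βs i, Y i))) by ring, norm_mul]
      refine mul_le_mul_of_nonneg_left ((norm_sub_le _ _).trans (add_le_add ?_ ?_)) (norm_nonneg _)
      · exact (norm_sum_le _ _).trans (sum_le_sum fun β _ => (norm_prod_le _ _))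
      · exact (norm_sum_le _ _).trans (sum_le_sum fun βs _ => (norm_prod_le _ _))
    · -- a leg outside `β₀`: no glued term
      rw [sub_zero, add_zero, norm_mul, mul_comm]
      refine mul_le_mul_of_nonneg_left ((norm_add_le _ _).trans ?_) (norm_nonneg _)
      rw [add_comm]
      exact add_le_add ((norm_sum_le _ _).trans (sum_le_sum fun β _ => (norm_prod_le _ _))) (norm_prod_le _ _)
  -- sum over `Y`: the difference of the two sums is the sum of the differences
  have hsplit : (∑ Y : Fin (n + 1) → Γ₁, ∑ β : ι, (∏ i, T' (X' i) (e₁.symm (β, Y i))) * kernel 𝕜 V (n + 1) Y) -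
      (if ∀ i, (e₂ (X' i)).1 = β₀ then ∑ Y : Fin (n + 1) → Γ₁, (∏ i, T (e₂ (X' i)).2 (Y i)) * kernel 𝕜 V (n + 1) Y else 0) =
      ∑ Y : Fin (n + 1) → Γ₁, ((∑ β : ι, (∏ i, T' (X' i) (e₁.symm (β, Y i))) * kernel 𝕜 V (n + 1) Y) -
        (if ∀ i, (e₂ (X' i)).1 = β₀ then (∏ i, T (e₂ (X' i)).2 (Y i)) * kernel 𝕜 V (n + 1) Y else 0)) := by
    rw [Finset.sum_sub_distrib]
    split_ifs <;> simp
  rw [hsplit]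
  exact (norm_sum_le _ _).trans (sum_le_sum fun Y _ => hkey Y)

/-! ### §4 Pinned sums of leg-wise products -/

/-- **The pinned sum of a leg-wise product**: `Σ_{X′ : X′_p = w} ∏_i f_i(X′_i) = f_p(w) · ∏_{i ≠ p} Σ_x f_i(x)`. [folklore] -/
theorem sum_pinned_prod_eq {m : ℕ} (f : Fin m → Γ₂' → ℝ) (p : Fin m) (w : Γ₂') :
    ∑ X' ∈ univ.filter (fun X' : Fin m → Γ₂' => X' p = w), ∏ i, f i (X' i) = f p w * ∏ i ∈ univ.erase p, ∑ x, f i x := by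
  classical
  set t : Fin m → Finset Γ₂' := fun i => if i = p then {w} else univ with ht
  have hset : univ.filter (fun X' : Fin m → Γ₂' => X' p = w) = Fintype.piFinset t := by
    ext X'
    simp only [mem_filter, mem_univ, true_and, Fintype.mem_piFinset, ht]
    constructor
    · intro h i
      split_ifs with hi
      · subst hi; simp [h]
      · exact mem_univ _
    · intro h
      simpa using h p
  rw [hset, ← prod_univ_sum t, ← Finset.mul_prod_erase univ (fun i => ∑ j ∈ t i, f i j) (mem_univ p)]
  congr 1
  · simp only [ht, if_true, sum_singleton]
  · refine prod_congr rfl fun i hi => ?_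
    rw [mem_erase] at hi
    simp only [ht, if_neg hi.1]

end SubstitutionGluing

end Summit.HubbardSuperconductivity.HubbardSuperconductivity.Theorems.TwoVolumeDefect

end
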